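import Literature.NumberTheory.EllipticCurves.IsogenyPeriodLatticeProofs
import Literature.NumberTheory.EllipticCurves.ModularPolynomialIntegral
import Literature.NumberTheory.EllipticCurves.ModularLinkConjugacy
import HarnessLib

/-!
# A `ℚ`-isogeny of prime degree `ℓ` links the `j`-invariants by the modular equation `Φ_ℓ`

Topic `NumberTheory/EllipticCurves`; theorems only (no definition, no named fact, no instance).
For elliptic curves `W, W'` over `ℚ` and an isogeny `φ : W → W'` defined over `ℚ`
(`WeierstrassCurve.Isogeny`, degree `= #ker` on `ℚ̄`-points) of **prime** degree `ℓ`: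

* `WeierstrassCurve.Isogeny.evalXY_intModularPolynomial_j_of_degree_eq_prime` —
  **`Φ_ℓ(j(W), j(W')) = 0` and `Φ_ℓ(j(W'), j(W)) = 0`** for the integer modular equation
  `Φ_ℓ = intModularPolynomial ℓ ∈ ℤ[Y][X]` of the tree (Cox, *Primes of the form x² + ny²*,
  Thm. 11.18 (i); `ModularPolynomialIntegral.lean`), evaluated by the tree's `evalXY`;
* `WeierstrassCurve.Isogeny.j_eq_of_degree_eq_one` — an isogeny of degree `1` preserves `j`.

Proof (Silverman, *AEC*, VI.4.1(b) with Cox §11.B (11.14)–(11.15)): over `ℂ` the isogeny is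
`z ↦ αz : ℂ/Λ → ℂ/Λ'` with `[Λ' : αΛ] = deg φ` (the tree's
`WeierstrassCurve.Isogeny.exists_multiplier_of_isShort`, after passing to short models by the
`u = 1` changes of variables of `IsogenyPeriodLatticeProofs.lean`); writing `Λ' = c(ℤτ + ℤ)`,
`τ ∈ ℍ`, a sublattice of prime index `ℓ` is `c(ℤℓτ + ℤ)` or `c(ℤ(τ + k) + ℤℓ)`
(`PeriodPair.lattice_eq_of_relIndex_eq_prime`), whose `j`-invariants are `j(ℓτ)` and
`j((τ + k)/ℓ)`; and `Φ_ℓ(j(ℓτ), j(τ)) = 0 = Φ_ℓ(j((τ + k)/ℓ), j(τ))` are the tree's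
`intModularPolynomial_kleinJ_mulPoint` / `_divPoint` (the reversed relations follow from the same
two identities at `ℓτ`, resp. `(τ + k)/ℓ`, and the `T`-invariance of `j`).

These are the inputs of the local analysis of Pasten's Lemma 6.8
(`PastenHeightBoundsLemma68LocalProofs.lean`: along a prime-degree `ℚ`-isogeny the exponent
`ord_p Δ_min` at a multiplicative prime is multiplied or divided by `ℓ`).

## Mathlib / tree search

Tree: `WeierstrassCurve.Isogeny.exists_multiplier_of_isShort`, `exists_degree_eq_of_smul`,
`shortChange_a₁_a₂_a₃` (`IsogenyPeriodLatticeProofs.lean`); `PeriodPair.j`, `j_mulLeft`,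
`j_eq_of_lattice_eq`, `j_eq_weierstrassCurve_j`, `exists_lattice_eq_mulLeft_ofUpperHalfPlane`
(`LatticeJInvariant.lean`), `kleinJ_eq_periodPair_j`, `kleinJ_smul` (`ModularCurveKleinJ.lean`),
`intModularPolynomial_kleinJ_mulPoint/_divPoint` (`ModularPolynomialIntegral.lean`), `evalXY`,
`map_evalXY` (`ModularLinkConjugacy.lean`).  The sublattice dichotomy of
`DiophantineGeometry/FaltingsHeightIsogenyFiniteProofs.lean` (`valuationSubring_dichotomy_of_le`,
via Smith normal form, for the Faltings height) concerns `Δ(L)/Δ(M)` and integrality, not the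
modular equation at a given prime index; its two small lemmas `PeriodPair.j_mulLeft_ofUpperHalfPlane`,
`PeriodPair.divPoint_zero_mulPoint` are re-proved here (as `…_eq_kleinJ`, `…_eq`) rather than
importing that file.
Mathlib: `AddSubgroup.relIndex`, `AddSubgroup.nsmul_relIndex_mem`, `AddSubgroup.relIndex_eq_one`,
`zmultiples_eq_top_of_prime_card`, `Prime.coprime_iff_not_dvd`, `UpperHalfPlane.modular_T_zpow_smul`.

## References

* J. H. Silverman, *The Arithmetic of Elliptic Curves*, 2nd ed., GTM 106 (2009), Thm. VI.4.1(b),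
  III.4–III.6. [SilvermanAEC2009]
* D. A. Cox, *Primes of the form x² + ny²*, 2nd ed., Wiley 2013, §11.B (11.14)–(11.15), §11.C
  Thm. 11.18. [Cox2013]
* S. Lang, *Elliptic Functions*, 2nd ed., GTM 112 (1987), Ch. 5 §2–§3 (isogenies of degree `ℓ`
  and the modular equation).
-/

noncomputable section

open scoped Classical

open Polynomial

namespace PeriodPair

open Literature.NumberTheory.EllipticCurves Literature.NumberTheory.EllipticCurves.ModularForms
open UpperHalfPlane hiding I

/-! ### Sublattices of prime index of `c(ℤτ + ℤ)` -/

/-- Membership in `c(ℤτ + ℤ)`: `x ∈ cΛ_τ ↔ x = c(mτ + n)` for some integers `m, n`. [folklore] -/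
theorem mem_mulLeft_ofUpperHalfPlane_lattice {τ : ℍ} {c : ℂ} {hc : c ≠ 0} {x : ℂ} :
    x ∈ ((ofUpperHalfPlane τ).mulLeft c hc).lattice ↔ ∃ m n : ℤ, x = c * (m * (τ : ℂ) + n) := by
  rw [mem_mulLeft_lattice, mem_lattice]
  simp only [ofUpperHalfPlane_ω₁, ofUpperHalfPlane_ω₂, mul_one]
  constructor
  · rintro ⟨m, n, h⟩
    exact ⟨m, n, by rw [h, ← mul_assoc, mul_inv_cancel₀ hc, one_mul]⟩
  · rintro ⟨m, n, h⟩
    exact ⟨m, n, by rw [h, ← mul_assoc, inv_mul_cancel₀ hc, one_mul]⟩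

/-- `c(mτ + n) ∈ c(ℤτ + ℤ)`. [folklore] -/
theorem mul_mem_mulLeft_ofUpperHalfPlane_lattice (τ : ℍ) {c : ℂ} (hc : c ≠ 0) (m n : ℤ) :
    c * (m * (τ : ℂ) + n) ∈ ((ofUpperHalfPlane τ).mulLeft c hc).lattice :=
  mem_mulLeft_ofUpperHalfPlane_lattice.mpr ⟨m, n, rfl⟩

/-- **Sublattices of prime index.** Let `Λ' = c(ℤτ + ℤ)` (`τ ∈ ℍ`, `c ≠ 0`) and let `M` be a period
lattice contained in `Λ'` with `[Λ' : M] = ℓ` prime. Then either `M = c(ℤ·ℓτ + ℤ)` or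
`M = cℓ(ℤ·(τ + k)/ℓ + ℤ) = c(ℤ(τ + k) + ℤℓ)` for some integer `k` (the `ℓ + 1` sublattices of
index `ℓ`; Cox §11.B, the cosets `C(ℓ)`, Lang, *Elliptic Functions*, Ch. 5 §2). Proof: `ℓΛ' ⊆ M`;
if `c ∈ M` then `mτ` with `ℓ ∤ m` cannot occur in `M` (else `cτ ∈ M` by Bézout and `M = Λ'`); if
`c ∉ M`, the class of `c` generates the quotient `Λ'/M` of prime order, so `c(τ + k) ∈ M` for some
`k`, and again Bézout excludes `c·r ∈ M` with `ℓ ∤ r`. [cite: Cox2013, §11.B (11.12)–(11.14)] -/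
theorem lattice_eq_of_relIndex_eq_prime (ℓ : ℕ) [Fact ℓ.Prime] {τ : ℍ} {c : ℂ} (hc : c ≠ 0)
    {M : PeriodPair} (hle : M.lattice ≤ ((ofUpperHalfPlane τ).mulLeft c hc).lattice)
    (hind : M.lattice.toAddSubgroup.relIndex
      ((ofUpperHalfPlane τ).mulLeft c hc).lattice.toAddSubgroup = ℓ) :
    M.lattice = ((ofUpperHalfPlane (mulPoint ℓ τ)).mulLeft c hc).lattice ∨
      ∃ k : ℤ, M.lattice = ((ofUpperHalfPlane (divPoint ℓ k τ)).mulLeft (c * ℓ)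
        (mul_ne_zero hc (Nat.cast_ne_zero.mpr (Fact.out : ℓ.Prime).ne_zero))).lattice := by
  have hℓ := (Fact.out : ℓ.Prime)
  have hℓ0 : (ℓ : ℂ) ≠ 0 := Nat.cast_ne_zero.mpr hℓ.ne_zero
  set Λ := ((ofUpperHalfPlane τ).mulLeft c hc).lattice with hΛdef
  -- (a) `ℓ x ∈ M` for every `x ∈ Λ'`
  have hmul : ∀ x ∈ Λ, (ℓ : ℂ) * x ∈ M.lattice := by
    intro x hx
    have h := AddSubgroup.nsmul_relIndex_mem (H := M.lattice.toAddSubgroup)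
      (K := Λ.toAddSubgroup) (g := x) hx
    rw [hind, nsmul_eq_mul] at h
    exact h
  have hcτ : c * (τ : ℂ) ∈ Λ := by
    simpa using mul_mem_mulLeft_ofUpperHalfPlane_lattice τ hc 1 0
  have hc1 : c ∈ Λ := by
    simpa using mul_mem_mulLeft_ofUpperHalfPlane_lattice τ hc 0 1
  have hℓcτ : c * ((ℓ : ℂ) * τ) ∈ M.lattice := by
    have := hmul _ hcτ
    convert this using 1
    ring
  have hℓc : c * (ℓ : ℂ) ∈ M.lattice := by
    have := hmul _ hc1
    rw [mul_comm] at this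
    exact this
  -- Bézout: if `c r ∈ M` with `ℓ ∤ r` then `c ∈ M`; if `c m τ ∈ M` with `ℓ ∤ m` then `c τ ∈ M`
  have hbez : ∀ (y : ℂ) (r : ℤ), ¬ (ℓ : ℤ) ∣ r → c * (r * y) ∈ M.lattice →
      c * ((ℓ : ℂ) * y) ∈ M.lattice → c * y ∈ M.lattice := by
    intro y r hr hry hℓy
    have hcop : IsCoprime (ℓ : ℤ) r :=
      (Prime.coprime_iff_not_dvd (Nat.prime_iff_prime_int.mp hℓ)).mpr hr
    obtain ⟨b, a, hab⟩ := hcop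
    have key : c * y = (a : ℂ) * (c * (r * y)) + (b : ℂ) * (c * ((ℓ : ℂ) * y)) := by
      have hab' : (b : ℂ) * ℓ + a * r = 1 := by exact_mod_cast hab
      linear_combination (-(c * y)) * hab'
    rw [key]
    refine add_mem ?_ ?_
    · rw [← zsmul_eq_mul]; exact M.lattice.smul_mem a hry
    · rw [← zsmul_eq_mul]; exact M.lattice.smul_mem b hℓy
  -- `M ≠ Λ'`
  have hne : ¬ (Λ ≤ M.lattice) := by
    intro h
    have h1 : M.lattice.toAddSubgroup.relIndex Λ.toAddSubgroup = 1 :=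
      AddSubgroup.relIndex_eq_one.mpr h
    rw [hind] at h1
    exact hℓ.one_lt.ne' h1
  by_cases hcM : c ∈ M.lattice
  · -- Case 1: `c ∈ M`, so `M = c(ℤℓτ + ℤ)`
    left
    apply le_antisymm
    · intro x hx
      obtain ⟨m, n, rfl⟩ := mem_mulLeft_ofUpperHalfPlane_lattice.mp (hle hx)
      -- `ℓ ∣ m`, else `cτ ∈ M` and `M = Λ'`
      have hdvd : (ℓ : ℤ) ∣ m := by
        by_contra hndvd
        have hmτ : c * (m * (τ : ℂ)) ∈ M.lattice := by
          have h1 : c * (m * (τ : ℂ)) = c * (m * (τ : ℂ) + n) - (n : ℤ) • c := by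
            rw [zsmul_eq_mul]; ring
          rw [h1]
          exact sub_mem hx (M.lattice.smul_mem n hcM)
        have hτM : c * (τ : ℂ) ∈ M.lattice := hbez τ m hndvd hmτ hℓcτ
        apply hne
        intro y hy
        obtain ⟨m', n', rfl⟩ := mem_mulLeft_ofUpperHalfPlane_lattice.mp hy
        have h2 : c * (m' * (τ : ℂ) + n') = (m' : ℤ) • (c * (τ : ℂ)) + (n' : ℤ) • c := by
          simp only [zsmul_eq_mul]; ring
        rw [h2]
        exact add_mem (M.lattice.smul_mem m' hτM) (M.lattice.smul_mem n' hcM)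
      obtain ⟨m', rfl⟩ := hdvd
      refine mem_mulLeft_ofUpperHalfPlane_lattice.mpr ⟨m', n, ?_⟩
      simp only [coe_mulPoint, Int.cast_mul, Int.cast_natCast]
      ring
    · intro x hx
      obtain ⟨m, n, rfl⟩ := mem_mulLeft_ofUpperHalfPlane_lattice.mp hx
      have h2 : c * (m * ((mulPoint ℓ τ : ℍ) : ℂ) + n) =
          (m : ℤ) • (c * ((ℓ : ℂ) * τ)) + (n : ℤ) • c := by
        simp only [zsmul_eq_mul, coe_mulPoint]; ring
      rw [h2]
      exact add_mem (M.lattice.smul_mem m hℓcτ) (M.lattice.smul_mem n hcM)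
  · -- Case 2: `c ∉ M`; the class of `c` generates `Λ'/M`, of prime order `ℓ`
    right
    set H : AddSubgroup Λ.toAddSubgroup := M.lattice.toAddSubgroup.addSubgroupOf Λ.toAddSubgroup
      with hHdef
    have hcardQ : Nat.card (Λ.toAddSubgroup ⧸ H) = ℓ := by
      rw [← AddSubgroup.index_eq_card]
      exact hind
    have hc0 : (QuotientAddGroup.mk (⟨c, hc1⟩ : Λ.toAddSubgroup) : Λ.toAddSubgroup ⧸ H) ≠ 0 := by
      intro h0
      rw [QuotientAddGroup.eq_zero_iff, hHdef, AddSubgroup.mem_addSubgroupOf] at h0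
      exact hcM h0
    have htop := zmultiples_eq_top_of_prime_card hcardQ hc0
    have hτmem : (QuotientAddGroup.mk (⟨c * (τ : ℂ), hcτ⟩ : Λ.toAddSubgroup) : Λ.toAddSubgroup ⧸ H) ∈
        AddSubgroup.zmultiples (QuotientAddGroup.mk (⟨c, hc1⟩ : Λ.toAddSubgroup)) := by
      rw [htop]; exact AddSubgroup.mem_top _
    obtain ⟨k', hk'⟩ := AddSubgroup.mem_zmultiples_iff.mp hτmem
    rw [← QuotientAddGroup.mk_zsmul, QuotientAddGroup.eq, hHdef, AddSubgroup.mem_addSubgroupOf]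
      at hk'
    -- `c(τ + k) ∈ M` with `k = -k'`
    set k : ℤ := -k' with hkdef
    have hτk : c * ((τ : ℂ) + k) ∈ M.lattice := by
      have h1 : c * ((τ : ℂ) + k) = -(k' • c) + c * (τ : ℂ) := by
        simp only [hkdef, zsmul_eq_mul, Int.cast_neg]; ring
      rw [h1]
      exact hk'
    refine ⟨k, le_antisymm ?_ ?_⟩
    · intro x hx
      obtain ⟨m, n, rfl⟩ := mem_mulLeft_ofUpperHalfPlane_lattice.mp (hle hx)
      -- `r = n - m k` is divisible by `ℓ`
      have hrM : c * ((n - m * k : ℤ) * (1 : ℂ)) ∈ M.lattice := by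
        have h1 : c * ((n - m * k : ℤ) * (1 : ℂ)) =
            c * (m * (τ : ℂ) + n) - (m : ℤ) • (c * ((τ : ℂ) + k)) := by
          simp only [zsmul_eq_mul, Int.cast_sub, Int.cast_mul]; ring
        rw [h1]
        exact sub_mem hx (M.lattice.smul_mem m hτk)
      have hdvd : (ℓ : ℤ) ∣ n - m * k := by
        by_contra hndvd
        have h := hbez 1 (n - m * k) hndvd hrM (by simpa using hℓc)
        rw [mul_one] at h
        exact hcM h
      obtain ⟨s, hs⟩ := hdvd
      refine mem_mulLeft_ofUpperHalfPlane_lattice.mpr ⟨m, s, ?_⟩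
      have hn : (n : ℂ) = m * k + ℓ * s := by
        have : (n : ℤ) = m * k + ℓ * s := by omega
        exact_mod_cast this
      simp only [coe_divPoint]
      rw [hn]
      field_simp
      ring
    · intro x hx
      obtain ⟨m, n, rfl⟩ := mem_mulLeft_ofUpperHalfPlane_lattice.mp hx
      have h2 : c * (ℓ : ℂ) * (m * ((divPoint ℓ k τ : ℍ) : ℂ) + n) =
          (m : ℤ) • (c * ((τ : ℂ) + k)) + (n : ℤ) • (c * (ℓ : ℂ)) := by
        simp only [zsmul_eq_mul, coe_divPoint]
        field_simp
      rw [h2]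
      exact add_mem (M.lattice.smul_mem m hτk) (M.lattice.smul_mem n hℓc)

/-- `j(c Λ_τ) = j(τ)` (the lemma `PeriodPair.j_mulLeft_ofUpperHalfPlane` of
`DiophantineGeometry/FaltingsHeightIsogenyFiniteProofs.lean`, not imported here). [folklore] -/
theorem j_mulLeft_ofUpperHalfPlane_eq_kleinJ (τ : ℍ) (c : ℂ) (hc : c ≠ 0) :
    ((ofUpperHalfPlane τ).mulLeft c hc).j = kleinJ τ := by
  rw [j_mulLeft, kleinJ_eq_periodPair_j]

/-- `((ℓτ) + 0)/ℓ = τ`: `divPoint ℓ 0 (mulPoint ℓ τ) = τ` (the lemma `PeriodPair.divPoint_zero_mulPoint`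
of `DiophantineGeometry/FaltingsHeightIsogenyFiniteProofs.lean`, not imported here). [folklore] -/
theorem divPoint_zero_mulPoint_eq (ℓ : ℕ) [Fact ℓ.Prime] (τ : ℍ) :
    divPoint ℓ 0 (mulPoint ℓ τ) = τ := by
  have hℓ0 : (ℓ : ℂ) ≠ 0 := Nat.cast_ne_zero.mpr (Fact.out : ℓ.Prime).ne_zero
  apply UpperHalfPlane.ext
  simp only [coe_divPoint, coe_mulPoint, Int.cast_zero, add_zero]
  field_simp

/-- `ℓ · (τ + k)/ℓ = τ + k = T^k τ`, so `j(ℓ · divPoint ℓ k τ) = j(τ)`. [folklore] -/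
theorem kleinJ_mulPoint_divPoint (ℓ : ℕ) [Fact ℓ.Prime] (k : ℤ) (τ : ℍ) :
    kleinJ (mulPoint ℓ (divPoint ℓ k τ)) = kleinJ τ := by
  have hℓ0 : (ℓ : ℂ) ≠ 0 := Nat.cast_ne_zero.mpr (Fact.out : ℓ.Prime).ne_zero
  have h : mulPoint ℓ (divPoint ℓ k τ) = ModularGroup.T ^ k • τ := by
    rw [UpperHalfPlane.modular_T_zpow_smul]
    apply UpperHalfPlane.ext
    simp only [coe_mulPoint, coe_divPoint, UpperHalfPlane.coe_vadd, Complex.ofReal_intCast]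
    field_simp
    ring
  rw [h, kleinJ_smul]

/-- **The modular equation along a sublattice of prime index.** If the period lattice `M` is
contained in the period lattice `Λ'` with `[Λ' : M] = ℓ` prime, then `Φ_ℓ(j(M), j(Λ')) = 0` and
`Φ_ℓ(j(Λ'), j(M)) = 0` for the integer modular equation `Φ_ℓ` (Cox (11.14)–(11.15):
`Φ_ℓ(j(ℓτ), j(τ)) = 0 = Φ_ℓ(j((τ+k)/ℓ), j(τ))`, the tree's `intModularPolynomial_kleinJ_mulPoint` /
`_divPoint`, applied to `Λ' = c(ℤτ + ℤ)` and the classification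
`lattice_eq_of_relIndex_eq_prime`; the reversed relations are the same identities at `ℓτ` and at
`(τ + k)/ℓ`, with `j(τ + k) = j(τ)`). [cite: Cox2013, §11.B (11.14)–(11.15)] -/
theorem evalXY_intModularPolynomial_j_of_relIndex_eq_prime (ℓ : ℕ) [Fact ℓ.Prime]
    {M L' : PeriodPair} (hle : M.lattice ≤ L'.lattice)
    (hind : M.lattice.toAddSubgroup.relIndex L'.lattice.toAddSubgroup = ℓ) :
    evalXY (intModularPolynomial ℓ) M.j L'.j = 0 ∧
      evalXY (intModularPolynomial ℓ) L'.j M.j = 0 := by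
  obtain ⟨τ, c, hc, hL'⟩ := L'.exists_lattice_eq_mulLeft_ofUpperHalfPlane
  rw [j_eq_of_lattice_eq hL', j_mulLeft_ofUpperHalfPlane_eq_kleinJ]
  rw [hL'] at hle hind
  rcases lattice_eq_of_relIndex_eq_prime ℓ hc hle hind with hM | ⟨k, hM⟩
  · rw [j_eq_of_lattice_eq hM, j_mulLeft_ofUpperHalfPlane_eq_kleinJ]
    refine ⟨intModularPolynomial_kleinJ_mulPoint ℓ τ, ?_⟩
    have h := intModularPolynomial_kleinJ_divPoint ℓ 0 (mulPoint ℓ τ)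
    rw [divPoint_zero_mulPoint_eq] at h
    exact h
  · rw [j_eq_of_lattice_eq hM, j_mulLeft_ofUpperHalfPlane_eq_kleinJ]
    refine ⟨intModularPolynomial_kleinJ_divPoint ℓ k τ, ?_⟩
    have h := intModularPolynomial_kleinJ_mulPoint ℓ (divPoint ℓ k τ)
    rw [kleinJ_mulPoint_divPoint] at h
    exact h

/-- A period lattice of relative index `1` in another is equal to it, so both have the same
`j`-invariant. [folklore] -/
theorem j_eq_of_relIndex_eq_one {M L' : PeriodPair} (hle : M.lattice ≤ L'.lattice)
    (hind : M.lattice.toAddSubgroup.relIndex L'.lattice.toAddSubgroup = 1) : M.j = L'.j := by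
  refine j_eq_of_lattice_eq (le_antisymm hle ?_)
  intro x hx
  exact AddSubgroup.relIndex_eq_one.mp hind hx

end PeriodPair

/-! ### `ℚ`-isogenies of prime degree -/

namespace WeierstrassCurve

namespace Isogeny

open Literature.NumberTheory.EllipticCurves _root_.PeriodPair

variable {W W' : WeierstrassCurve ℚ} [W.IsElliptic] [W'.IsElliptic]

/-- **The period lattices of a `ℚ`-isogeny.** For an isogeny `φ : W → W'` of elliptic curves over
`ℚ` there are period pairs `M, Λ'` with `j(M) = j(W)`, `j(Λ') = j(W')` (in `ℂ`), `M ⊆ Λ'` and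
`[Λ' : M] = deg φ`: over `ℂ` the isogeny is `z ↦ αz : ℂ/Λ → ℂ/Λ'` with `[Λ' : αΛ] = deg φ`
(Silverman, *AEC*, Thm. VI.4.1(b); the tree's `exists_multiplier_of_isShort` after the `u = 1`
changes of variables to short models, which preserve `j` and the degree), and `M = αΛ` has the
`j`-invariant of `Λ`, i.e. of `W`. [cite: SilvermanAEC2009, Thm. VI.4.1(b) (PDF pp. 152–154)] -/
theorem exists_periodPair_j_eq_relIndex_eq_degree (φ : Isogeny W W') :
    ∃ M L' : PeriodPair, M.j = ((W.j : ℚ) : ℂ) ∧ L'.j = ((W'.j : ℚ) : ℂ) ∧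
      M.lattice ≤ L'.lattice ∧
        M.lattice.toAddSubgroup.relIndex L'.lattice.toAddSubgroup = φ.degree := by
  classical
  haveI : Invertible (2 : ℚ) := invertibleOfNonzero two_ne_zero
  haveI : Invertible (3 : ℚ) := invertibleOfNonzero three_ne_zero
  set C : VariableChange ℚ := ⟨1, -W.b₂ / 12, -W.a₁ / 2, W.a₁ * W.b₂ / 24 - W.a₃ / 2⟩ with hC
  set C' : VariableChange ℚ := ⟨1, -W'.b₂ / 12, -W'.a₁ / 2, W'.a₁ * W'.b₂ / 24 - W'.a₃ / 2⟩
    with hC'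
  obtain ⟨h₁, h₂, h₃⟩ := shortChange_a₁_a₂_a₃ W
  obtain ⟨h₁', h₂', h₃'⟩ := shortChange_a₁_a₂_a₃ W'
  obtain ⟨ψ, hψ⟩ := exists_degree_eq_of_smul φ C C'
  obtain ⟨α₀, hα₀, -, han⟩ := exists_multiplier_of_isShort ψ h₁ h₂ h₃ h₁' h₂' h₃'
  set σ : ℚ →+* ℂ := algebraMap ℚ ℂ with hσ
  obtain ⟨L, hL₂, hL₃⟩ := ((C • W).map σ).exists_periodPair_of_isElliptic'
  obtain ⟨L', hL₂', hL₃'⟩ := ((C' • W').map σ).exists_periodPair_of_isElliptic'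
  obtain ⟨hσα, hle, hdeg⟩ := han σ L L' hL₂ hL₃ hL₂' hL₃'
  refine ⟨L.mulLeft (σ α₀) hσα, L', ?_, ?_, hle, hdeg.trans hψ⟩
  · rw [j_mulLeft, j_eq_weierstrassCurve_j hL₂ hL₃, map_j, variableChange_j]
    rfl
  · rw [j_eq_weierstrassCurve_j hL₂' hL₃', map_j, variableChange_j]
    rfl

/-- **A `ℚ`-isogeny of prime degree `ℓ` satisfies the modular equation of level `ℓ`**: for
elliptic curves `W, W'` over `ℚ` and an isogeny `φ : W → W'` over `ℚ` with `deg φ = ℓ` prime,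
`Φ_ℓ(j(W), j(W')) = 0` and `Φ_ℓ(j(W'), j(W)) = 0`, `Φ_ℓ = intModularPolynomial ℓ ∈ ℤ[Y][X]`
(Cox Thm. 11.18 with (11.14)–(11.15): `j(E)` and `j(E')` for a cyclic `ℓ`-isogeny `E → E'` over
`ℂ` are `j(τ)` and one of `j(ℓτ)`, `j((τ + k)/ℓ)`; Silverman *AEC* VI.4.1(b) for the passage from
the isogeny to the lattices). Proved in `ℂ` (`exists_periodPair_j_eq_relIndex_eq_degree`,
`PeriodPair.evalXY_intModularPolynomial_j_of_relIndex_eq_prime`) and pulled back along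
`ℚ ↪ ℂ`. [cite: Cox2013, §11.C Thm. 11.18 and §11.B (11.14)–(11.15)] -/
theorem evalXY_intModularPolynomial_j_of_degree_eq_prime (φ : Isogeny W W') {ℓ : ℕ}
    [Fact ℓ.Prime] (hdeg : φ.degree = ℓ) :
    evalXY (intModularPolynomial ℓ) W.j W'.j = 0 ∧
      evalXY (intModularPolynomial ℓ) W'.j W.j = 0 := by
  obtain ⟨M, L', hjM, hjL', hle, hind⟩ := φ.exists_periodPair_j_eq_relIndex_eq_degree
  rw [hdeg] at hind
  obtain ⟨h1, h2⟩ := PeriodPair.evalXY_intModularPolynomial_j_of_relIndex_eq_prime ℓ hle hind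
  rw [hjM, hjL'] at h1 h2
  have hinj : Function.Injective (algebraMap ℚ ℂ) := (algebraMap ℚ ℂ).injective
  constructor
  · apply hinj
    rw [map_evalXY, map_zero]
    exact h1
  · apply hinj
    rw [map_evalXY, map_zero]
    exact h2

/-- **An isogeny of degree `1` over `ℚ` preserves the `j`-invariant**: `deg φ = #ker φ = 1` means
`[Λ' : αΛ] = 1`, i.e. `αΛ = Λ'`, and homothetic lattices have the same `j` (Cox Thm. 10.9;
Silverman *AEC* VI.4.1(b) and III.4). [cite: SilvermanAEC2009, Thm. VI.4.1(b) (PDF pp. 152–154)] -/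
theorem j_eq_of_degree_eq_one (φ : Isogeny W W') (hdeg : φ.degree = 1) : W.j = W'.j := by
  obtain ⟨M, L', hjM, hjL', hle, hind⟩ := φ.exists_periodPair_j_eq_relIndex_eq_degree
  rw [hdeg] at hind
  have h := PeriodPair.j_eq_of_relIndex_eq_one hle hind
  rw [hjM, hjL'] at h
  exact_mod_cast h

end Isogeny

end WeierstrassCurve

end
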